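import Summits.ValiantsHypothesis.ValiantsHypothesis.Theorems.BarrierLeverTorusIsolatedDeterminantsHitByVP
import Summits.ValiantsHypothesis.ValiantsHypothesis.Theorems.DetqpThesis.Negative.IffPerNotVQP
import Summits.ValiantsHypothesis.ValiantsHypothesis.Theses.BarrierLever

/-!
# Route BarrierLever — the LADDER LINK item `ChowHitsReadOnceDeterminants` (stmt-ValiantsHypothesis-20239)
# ⇒ the constant-free part of item `ReadOnceDeterminantsHitByVP` (stmt-ValiantsHypothesis-20152), `b = 3`

Helper file (`--supports stmt-ValiantsHypothesis-20152`; cell val-lit, NP corpus, seat val-lit-p1; the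
link named in the cell's GAP-LEDGER rows N5/N7 and in item 20239's docstring «LADDER:
ChowHitsReadOnceDeterminants ⇒ the constant-free part of sibling item 20152 with b = 3»). Closes NO item.

Item 20239 says: for all large `n`, every injective constant-free placement `β` of degree-`≤ n`
exponent vectors in an `r × r` matrix is hit by ONE PRODUCT OF `n` AFFINE FORMS,
`det[coeff_{β(i,j)}(∏_k ℓ_k)] ≠ 0`. A product of `n` forms of degree `≤ 1` in `n` variables has
degree `≤ n` (`totalDegree_finsetProd`) and circuit size `≤ n(2n+1) + n ≤ n³` for `n ≥ 3` (affine
forms cost `≤ 2n+1` gates, `complexity_le_of_totalDegree_le_one`; products `complexity_finset_prod_le`),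
so it lies in `SmallCircuits ℂ n 3`; and evaluating the layout determinant at a coefficient vector is
the determinant of the evaluated layout (`TorusIsolation.Layout.eval_detPoly`). Hence item 20239 gives
item 20152's conclusion for every level `a` with the SAME size exponent `b = 3`, restricted to
CONSTANT-FREE read-once layouts (every entry a coefficient variable). The layouts with constants are
not reached by this link (torus-isolated ones are hit by `…TorusIsolation.torusIsolatedDeterminantsHitByVP`).

* `prod_affine_mem_smallCircuits` — `∏_{k<n} ℓ_k ∈ SmallCircuits ℂ n 3` for affine `ℓ_k`, `n ≥ 3`.
* `hits_constantFree_of_chow` — one `n`: the Chow statement at `n` hits every injective constant-free layout.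
* `constantFreeReadOnceDeterminants_hit_of_chowHitsReadOnceDeterminants` — the ladder link, with
  item 20152's distinguisher class verbatim plus the clause `∀ i j, ∃ m, E i j = Sum.inl m`.

WHAT THIS IS NOT: neither item is proved; layouts with constant entries (the torus-balanced ones with
constants in particular) are outside this link; nothing on FSV Question 6 / crux 14610 or `VP` vs `VNP`.

References: [ForbesShpilkaVolk2018] §8 (read-once determinants as the next distinguisher class);
[Burgisser2000] Rem. 2.7 (circuit-size bookkeeping).
-/

-- layout Summits/ValiantsHypothesis/ValiantsHypothesis forces the duplicated namespace component
set_option linter.dupNamespace false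

namespace Summit.ValiantsHypothesis.ValiantsHypothesis.Theorems.BarrierLever.ChowLadder

open MvPolynomial Literature.Barriers.ValiantsHypothesis Literature.Computability.AlgebraicComplexity
open Summit.ValiantsHypothesis.ValiantsHypothesis.Theorems.BarrierLever.TorusIsolation
open Summit.ValiantsHypothesis.Theorems.DetqpThesis.Negative (complexity_le_of_totalDegree_le_one)

variable {n r : ℕ}

/-- **A product of `n` affine forms in `n` variables is a small circuit** (`n ≥ 3`): degree `≤ n`,
size `≤ n(2n+1) + n ≤ n³`. [cite: Burgisser2000, Rem. 2.7] -/
theorem prod_affine_mem_smallCircuits (hn : 3 ≤ n) (ℓ : Fin n → MvPolynomial (Fin n) ℂ)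
    (hℓ : ∀ i, (ℓ i).totalDegree ≤ 1) : (∏ k, ℓ k) ∈ SmallCircuits ℂ n 3 := by
  refine ⟨?_, ?_⟩
  · calc (∏ k, ℓ k).totalDegree ≤ ∑ k, (ℓ k).totalDegree := totalDegree_finsetProd _ _
      _ ≤ ∑ _k : Fin n, 1 := Finset.sum_le_sum fun k _ => hℓ k
      _ = n := by simp
  · have hterm : ∀ k, complexity (ℓ k) ≤ 2 * n + 1 := fun k => by
      simpa [Fintype.card_fin] using complexity_le_of_totalDegree_le_one (hℓ k)
    calc complexity (∏ k, ℓ k) ≤ ∑ k, complexity (ℓ k) + (Finset.univ : Finset (Fin n)).card :=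
          complexity_finset_prod_le _ _
      _ ≤ ∑ _k : Fin n, (2 * n + 1) + n := by
          rw [Finset.card_univ, Fintype.card_fin]
          exact Nat.add_le_add_right (Finset.sum_le_sum fun k _ => hterm k) _
      _ = n * (2 * n + 1) + n := by simp
      _ ≤ n ^ 3 := by
          have h1 : 3 * n ≤ n * n := Nat.mul_le_mul_right n hn
          have h2 : 3 * (n * n) ≤ n * (n * n) := Nat.mul_le_mul_right (n * n) hn
          calc n * (2 * n + 1) + n = 2 * (n * n) + 2 * n := by ring
            _ ≤ 3 * (n * n) := by omega
            _ ≤ n * (n * n) := h2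
            _ = n ^ 3 := by ring

/-- The constant-free layout placed by `β`. [cite: ForbesShpilkaVolk2018, §8] -/
theorem eval_det_constantFree (β : Fin r × Fin r → degLEMonomials n) (f : MvPolynomial (Fin n) ℂ) :
    eval (coeffVector (degLEMonomials n) f)
        ((Matrix.of fun i j : Fin r => (Sum.inl (β (i, j)) : (degLEMonomials n) ⊕ ℂ)).map
          (Sum.elim MvPolynomial.X MvPolynomial.C)).det =
      (Matrix.of fun i j : Fin r => coeff ((β (i, j) : degLEMonomials n) : Fin n →₀ ℕ) f).det := by
  have h := Layout.eval_detPoly (coeffVector (degLEMonomials n) f)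
    (Matrix.of fun i j : Fin r => (Sum.inl (β (i, j)) : (degLEMonomials n) ⊕ ℂ))
  rw [Layout.detPoly] at h
  -- the evaluated layout IS the coefficient matrix, definitionally (`Matrix.map`, `Sum.elim`)
  exact h.trans rfl

/-- **One `n`: the Chow statement at `n` hits every injective constant-free layout by a member of
`SmallCircuits ℂ n 3`** (`n ≥ 3`). [cite: ForbesShpilkaVolk2018, §8] -/
theorem hits_constantFree_of_chow (hn : 3 ≤ n)
    (hchow : ∀ (r : ℕ) (β : Fin r × Fin r → degLEMonomials n), Function.Injective β →
      ∃ ℓ : Fin n → MvPolynomial (Fin n) ℂ, (∀ i, (ℓ i).totalDegree ≤ 1) ∧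
        (Matrix.of fun i j : Fin r =>
          coeff ((β (i, j) : degLEMonomials n) : Fin n →₀ ℕ) (∏ k, ℓ k)).det ≠ 0)
    (β : Fin r × Fin r → degLEMonomials n) (hβ : Function.Injective β) :
    ∃ f ∈ SmallCircuits ℂ n 3, eval (coeffVector (degLEMonomials n) f)
      ((Matrix.of fun i j : Fin r => (Sum.inl (β (i, j)) : (degLEMonomials n) ⊕ ℂ)).map
        (Sum.elim MvPolynomial.X MvPolynomial.C)).det ≠ 0 := by
  obtain ⟨ℓ, hℓ, hdet⟩ := hchow r β hβ
  refine ⟨∏ k, ℓ k, prod_affine_mem_smallCircuits hn ℓ hℓ, ?_⟩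
  rwa [eval_det_constantFree]

/-- A constant-free layout (`∀ i j, ∃ m, E i j = Sum.inl m`) IS the placement of some `β`; read-once
makes `β` injective. [cite: ForbesShpilkaVolk2018, §8] -/
theorem exists_beta_of_constantFree (E : Matrix (Fin r) (Fin r) ((degLEMonomials n) ⊕ ℂ))
    (hro : ∀ p q : Fin r × Fin r, ∀ m, E p.1 p.2 = Sum.inl m → E q.1 q.2 = Sum.inl m → p = q)
    (hcf : ∀ i j, ∃ m, E i j = Sum.inl m) :
    ∃ β : Fin r × Fin r → degLEMonomials n, Function.Injective β ∧
      E = Matrix.of fun i j => (Sum.inl (β (i, j)) : (degLEMonomials n) ⊕ ℂ) := by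
  choose m hm using hcf
  refine ⟨fun p => m p.1 p.2, fun p q hpq => hro p q (m p.1 p.2) (hm p.1 p.2) ?_, ?_⟩
  · simpa [hpq] using hm q.1 q.2
  · ext i j
    simp [hm i j]

/-- **LADDER LINK: item 20239 ⇒ the constant-free part of item 20152, with `b = 3` for every level `a`.**
The conclusion is item 20152's signature with its distinguisher class cut down by the one extra clause
`∀ i j, ∃ m, E i j = Sum.inl m` (no constant entries); the size bound `r ≤ N^a` is not even used.
[cite: ForbesShpilkaVolk2018, §8] -/
theorem constantFreeReadOnceDeterminants_hit_of_chowHitsReadOnceDeterminants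
    (h : Theses.BarrierLever.ChowHitsReadOnceDeterminants) :
    ∀ a : ℕ, ∃ b n₀ : ℕ, ∀ n : ℕ, n₀ ≤ n →
      IsSuccinctHittingSet (degLEMonomials n) (SmallCircuits ℂ n b)
        {D | ∃ (r : ℕ) (E : Matrix (Fin r) (Fin r) (↥(degLEMonomials n) ⊕ ℂ)),
          r ≤ (Nat.choose (2 * n) n) ^ a ∧
          (∀ p q : Fin r × Fin r, ∀ m, E p.1 p.2 = Sum.inl m → E q.1 q.2 = Sum.inl m → p = q) ∧
          (∀ i j, ∃ m, E i j = Sum.inl m) ∧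
          D = (E.map (Sum.elim MvPolynomial.X MvPolynomial.C)).det} := by
  obtain ⟨n₀, hn₀⟩ := h
  intro a
  refine ⟨3, max n₀ 3, fun n hn => ?_⟩
  have hn3 : 3 ≤ n := (le_max_right _ _).trans hn
  have hchow := hn₀ n ((le_max_left _ _).trans hn)
  rintro D ⟨r, E, -, hro, hcf, rfl⟩ _
  obtain ⟨β, hβ, rfl⟩ := exists_beta_of_constantFree E hro hcf
  exact hits_constantFree_of_chow hn3 hchow β hβ

/-- The same link stated for the explicit exponent: item 20239 ⇒ for all large `n`,
`SmallCircuits ℂ n 3` hits EVERY constant-free read-once determinantal layout (any size `r`).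
[cite: ForbesShpilkaVolk2018, §8] -/
theorem constantFreeReadOnce_hit_three_of_chowHitsReadOnceDeterminants
    (h : Theses.BarrierLever.ChowHitsReadOnceDeterminants) :
    ∃ n₀ : ℕ, ∀ n : ℕ, n₀ ≤ n →
      IsSuccinctHittingSet (degLEMonomials n) (SmallCircuits ℂ n 3)
        {D | ∃ (r : ℕ) (E : Matrix (Fin r) (Fin r) (↥(degLEMonomials n) ⊕ ℂ)),
          (∀ p q : Fin r × Fin r, ∀ m, E p.1 p.2 = Sum.inl m → E q.1 q.2 = Sum.inl m → p = q) ∧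
          (∀ i j, ∃ m, E i j = Sum.inl m) ∧
          D = (E.map (Sum.elim MvPolynomial.X MvPolynomial.C)).det} := by
  obtain ⟨n₀, hn₀⟩ := h
  refine ⟨max n₀ 3, fun n hn => ?_⟩
  have hn3 : 3 ≤ n := (le_max_right _ _).trans hn
  have hchow := hn₀ n ((le_max_left _ _).trans hn)
  rintro D ⟨r, E, hro, hcf, rfl⟩ _
  obtain ⟨β, hβ, rfl⟩ := exists_beta_of_constantFree E hro hcf
  exact hits_constantFree_of_chow hn3 hchow β hβ

end Summit.ValiantsHypothesis.ValiantsHypothesis.Theorems.BarrierLever.ChowLadder
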